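import Mathlib
import HarnessLib

/-! # Route MonotoneRestoration — crux `MonotoneRestorationQP`, line Sketch, stub D′2b
(stmt-ValiantsHypothesis-15886)

**Realising an adjacent transposition of rows.** A list `p ++ a :: b :: s` of `n` rows
(elements of `Fin n → α`) is the list of rows of the point `x (i, j) := (p ++ a :: b :: s)[i] j`
of the `n × n` matrix, and permuting the rows of `x` by the transposition
`Equiv.swap ⟨p.length, _⟩ ⟨p.length + 1, _⟩` gives the swapped list `p ++ b :: a :: s`.

Proof: both list identities are proved entrywise (`List.ext_getElem`, `List.getElem_ofFn`),
the second one by the case split `i < |p|`, `i = |p|`, `i = |p| + 1`, `|p| + 1 < i`.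
-/

-- `Summit.ValiantsHypothesis.ValiantsHypothesis.…` is the tree's mandated namespace (Sub = Summit).
set_option linter.dupNamespace false

namespace Summit.ValiantsHypothesis.ValiantsHypothesis.Theorems

/-- Entries of the swapped list `p ++ b :: a :: s` in terms of the original list
`p ++ a :: b :: s`: below `|p|` and above `|p| + 1` they agree, and the two middle entries are
exchanged. -/
theorem swapRealisation_getElem_swapped {β : Type} (p s : List β) (a b : β) (i : ℕ)
    (hi : i < (p ++ b :: a :: s).length) :
    (p ++ b :: a :: s)[i] =
      (p ++ a :: b :: s)[if i = p.length then p.length + 1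
          else if i = p.length + 1 then p.length else i]'(by
        simp only [List.length_append, List.length_cons] at hi ⊢
        split_ifs <;> omega) := by
  simp only [List.length_append, List.length_cons] at hi
  rcases Nat.lt_or_ge i p.length with h | h
  · have h1 : i ≠ p.length := by omega
    have h2 : i ≠ p.length + 1 := by omega
    simp only [h1, h2, if_false]
    rw [List.getElem_append_left h, List.getElem_append_left h]
  · rcases Nat.lt_or_ge i (p.length + 2) with h' | h'
    · rcases (show i = p.length ∨ i = p.length + 1 by omega) with rfl | rfl
      · simp
      · simp
    · have h1 : i ≠ p.length := by omega
      have h2 : i ≠ p.length + 1 := by omega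
      simp only [h1, h2, if_false]
      rw [List.getElem_append_right h, List.getElem_append_right h]
      obtain ⟨k, hk⟩ : ∃ k, i - p.length = k + 2 := ⟨i - p.length - 2, by omega⟩
      simp only [hk, List.getElem_cons_succ]

/-- **D′2b — REALISING AN ADJACENT TRANSPOSITION OF ROWS.** A list of `n` rows with two marked
adjacent positions is the list of rows of a point `x` of the `n × n` matrix, and the swapped
list is the list of rows of `x` with its rows permuted by the corresponding transposition.
[folklore] -/
theorem stub_swapRealisation {α : Type} (n : ℕ) (p s : List (Fin n → α)) (a b : Fin n → α)
    (hn : (p ++ a :: b :: s).length = n) :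
    ∃ (x : Fin n × Fin n → α) (σ : Equiv.Perm (Fin n)),
      (List.ofFn fun i : Fin n => fun j : Fin n => x (i, j)) = p ++ a :: b :: s ∧
      (List.ofFn fun i : Fin n => fun j : Fin n => x (σ i, j)) = p ++ b :: a :: s := by
  have hlen : p.length + 2 + s.length = n := by
    simp only [List.length_append, List.length_cons] at hn
    omega
  refine ⟨fun q => ((p ++ a :: b :: s)[(q.1 : ℕ)]'(by rw [hn]; exact q.1.isLt)) q.2,
    Equiv.swap ⟨p.length, by omega⟩ ⟨p.length + 1, by omega⟩, ?_, ?_⟩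
  · apply List.ext_getElem
    · simp [hn]
    · intro i h1 h2
      simp
  · apply List.ext_getElem
    · simp only [List.length_ofFn, List.length_append, List.length_cons]
      omega
    · intro i h1 h2
      rw [swapRealisation_getElem_swapped p s a b i h2]
      simp only [List.getElem_ofFn]
      have hσ : ((Equiv.swap (⟨p.length, by omega⟩ : Fin n) ⟨p.length + 1, by omega⟩)
          ⟨i, by simpa using h1⟩ : ℕ) =
          (if i = p.length then p.length + 1 else if i = p.length + 1 then p.length else i) := by
        rw [Equiv.swap_apply_def]
        simp only [Fin.ext_iff]
        split_ifs <;> rfl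
      funext j
      rw [getElem_congr_idx hσ]
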